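import Summits.Ventures.PercRepro.C041AnchorGlueSets

/-!
# ROW C-041 — THE TWO-EXIT ATTACHMENT: an unmarked multigraph with two zones hung at two of its vertices, and its
zone sets at the anchor (p6, gen 31; mine-3's C-041.md §20 (c) BLOCK MAPS with `r = 2` exits, §21 (a)–(b))

`glue2 Z₁ u u' Z a Z' a'` hangs the zone `Z'` (anchor `a'`) at the vertex `u'` of the UNMARKED multigraph `Z₁` and
then the zone `Z` (anchor `a`) at the vertex `u`: it is the anchor gluing `glue` of `C041AnchorGlue` (the host keeps
its marks — here the marks of `Z'`) applied to the pendant attachment `pendant Z₁ u' Z' a'` of `C041PendantZone`, so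
EVERY reach is read off the two landed constructions and no new reach lemma is needed.  A state is a colouring `ω₁`
of `Z₁` (`col₁`) with a state of `Z'` (`st'`) and a state of `Z` (`st`).  With the STATUSES of an exit `v` under
`ω₁` — merged `Z₁.Mg a₁ v ω₁` (blue-connected to the anchor `a₁`), reached `Z₁.Rd a₁ v ω₁` (red-connected) — and
the BLUE CONNECTION of the two exits `Z₁.Mg u u' ω₁` (`u'` in the blue component of `u`), the zone sets at the anchor `inl (inl a₁)` are:

* **`anchor_mem_D_iff`** — deleted iff `a'` is deleted in `Z'` and `u'` is merged, or `a` is deleted in `Z` and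
  `u` is merged (`anchor_mem_D2_iff` alike);
* **`adm_iff`** — both zones admissible and the junction `u` not deleted on both sides, where `u` collects the
  blue marks of `Z` and, through a blue path to `u'`, those of `Z'`;
* **`blueK_iff`** — a reached exit's zone is blue at its own `K`.

Two lemmas on the landed constructions come first: the red reach of a `Z₁`-vertex in a pendant attachment is the
reach inside `Z₁` (`Pendant.inl_mem_K_iff`), and `K` / «blue at `K`» of an anchor gluing FROM AN ARBITRARY ANCHOR
of the host (`AnchorGlue.inl_mem_K_iff_of_anchor`, `inr_mem_K_iff_of_anchor`, `blueK_iff_of_anchor`).  The six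
counts of the two-exit attachment over the colourings of `Z₁` are the next module.
-/

namespace PercRepro

namespace ZoneZ

open ZoneData

/-! ## Connectivity through a symmetric adjacency -/

section Conn

variable {V : Type*} {R : V → V → Prop}

/-- Connectivity is transitive: a vertex reached from `y`, with `y` reached from `z`, is reached from `z`. -/
theorem mem_reach_singleton_trans {x y z : V} (hxy : x ∈ reach R {y}) (hyz : y ∈ reach R {z}) :
    x ∈ reach R {z} :=
  reach_singleton_subset hyz hxy

end Conn

/-! ## The pendant attachment: the red reach of a `Z₁`-vertex -/

namespace Pendant

universe u₁ u₂ u₃ u₄ u₅ u₆ u₇ u₈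

variable {V₁ : Type u₁} {E₁ : Type u₂} {U₁ : Type u₃} {U₂ : Type u₄} {V₂ : Type u₅} {E₂ : Type u₆}
  {T₁ : Type u₇} {T₂ : Type u₈}
variable (Z₁ : ZoneData V₁ E₁ U₁ U₂) (u : V₁) (Z₂ : ZoneData V₂ E₂ T₁ T₂) (a₂ : V₂) (σ : State (E₁ ⊕ E₂) T₁ T₂)
  (a : V₁)

/-- A `Z₁`-vertex lies in the red reach of the anchor iff it is reached inside `Z₁`. -/
theorem inl_mem_K_iff (v : V₁) :
    Sum.inl v ∈ (pendant Z₁ u Z₂ a₂).K {Sum.inl a} σ ↔ Z₁.Rd a v (colL σ) := by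
  unfold K RedAdj
  rw [adj_eq_cAdj, inl_mem_reach_iff Z₁ u Z₂ a₂ true σ _ (stray_not_mem_singleton a₂ a), junction_singleton_iff]
  have e1 : leftSet ({Sum.inl a} : Set (V₁ ⊕ V₂)) = {a} := by
    ext v
    simp [leftSet]
  rw [e1]
  unfold Rd
  rw [← cAdj_true]
  constructor
  · rintro (h | ⟨hu, hv⟩)
    · exact h
    · exact mem_reach_singleton_trans hv hu
  · intro h
    exact Or.inl h

end Pendant

/-! ## The anchor gluing, seen from an arbitrary anchor of the host -/

namespace AnchorGlue

open Pendant

universe u₁ u₂ u₃ u₄ u₅ u₆ u₇ u₈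

variable {V₂ : Type u₁} {E₂ : Type u₂} {S₁ : Type u₃} {S₂ : Type u₄} {V₃ : Type u₅} {E₃ : Type u₆}
  {R₁ : Type u₇} {R₂ : Type u₈}
variable (Z₂ : ZoneData V₂ E₂ S₁ S₂) (a₂ : V₂) (Z₃ : ZoneData V₃ E₃ R₁ R₂) (a₃ : V₃)
  (σ : State (E₂ ⊕ E₃) (S₁ ⊕ R₁) (S₂ ⊕ R₂)) (a : V₂)

/-- The junction condition for the source `{inl a}`: the junction is connected to `a` inside `Z₂`. -/
theorem junction_singleton_iff_of_anchor (c : Bool) :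
    junction Z₂ a₂ Z₃ a₃ c (asPendant σ) {Sum.inl a} ↔ a₂ ∈ reach (cAdj Z₂ c (restrL σ).1) {a} := by
  rw [Pendant.junction_singleton_iff, colL_asPendant]

/-- A `Z₂`-vertex lies in the red reach of the anchor `a` iff it does inside `Z₂`. -/
theorem inl_mem_K_iff_of_anchor (x : V₂) :
    Sum.inl x ∈ (glue Z₂ a₂ Z₃ a₃).K {Sum.inl a} σ ↔ x ∈ Z₂.K {a} (restrL σ) := by
  unfold K RedAdj
  rw [adj_eq_cAdj, inl_mem_reach_iff Z₂ a₂ Z₃ a₃ true σ _ (by simp), junction_singleton_iff_of_anchor]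
  have e1 : leftSet ({Sum.inl a} : Set (V₂ ⊕ V₃)) = {a} := by
    ext v
    simp [leftSet]
  rw [e1, adj_eq_cAdj]
  constructor
  · rintro (h | ⟨hj, hx⟩)
    · exact h
    · exact mem_reach_singleton_trans hx hj
  · intro h
    exact Or.inl h

/-- A `Z₃`-vertex lies in the red reach of the anchor `a` iff it is not the stray vertex, the junction is reached
inside `Z₂` and the vertex lies in the red reach of `a₃` inside `Z₃`. -/
theorem inr_mem_K_iff_of_anchor (y : V₃) :
    Sum.inr y ∈ (glue Z₂ a₂ Z₃ a₃).K {Sum.inl a} σ ↔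
      y ≠ a₃ ∧ (a₂ ∈ Z₂.K {a} (restrL σ) ∧ y ∈ Z₃.K {a₃} (restrR σ)) := by
  unfold K RedAdj
  rw [adj_eq_cAdj, inr_mem_reach_iff Z₂ a₂ Z₃ a₃ true σ _ (by simp), junction_singleton_iff_of_anchor]
  have e2 : rightSet ({Sum.inl a} : Set (V₂ ⊕ V₃)) = ∅ := by
    ext y
    simp [rightSet]
  rw [e2, reach_empty]
  simp only [Set.mem_empty_iff_false, false_or]
  rfl

/-- **Blue at `K` from the anchor `a`**: `Z₂` is blue at its `K`, and if the junction is reached then `Z₃` is blue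
at its own `K`. -/
theorem blueK_iff_of_anchor :
    (glue Z₂ a₂ Z₃ a₃).blueK {Sum.inl a} σ ↔
      Z₂.blueK {a} (restrL σ) ∧ (a₂ ∈ Z₂.K {a} (restrL σ) → Z₃.blueK {a₃} (restrR σ)) := by
  unfold blueK
  rw [Set.disjoint_left]
  constructor
  · intro h
    constructor
    · rw [Set.disjoint_left]
      intro x hxK hxM
      refine h ((inl_mem_K_iff_of_anchor Z₂ a₂ Z₃ a₃ σ a x).2 hxK) ?_
      rcases hxM with hm | hm
      · exact Or.inl ((inl_mem_Blt_iff Z₂ a₂ Z₃ a₃ σ x).2 (Or.inl hm))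
      · exact Or.inr ((inl_mem_Mt_iff Z₂ a₂ Z₃ a₃ σ x).2 (Or.inl hm))
    · intro hj
      rw [Set.disjoint_left]
      intro y hyK hyM
      by_cases hy : y = a₃
      · subst hy
        refine h ((inl_mem_K_iff_of_anchor Z₂ a₂ Z₃ y σ a a₂).2 hj) ?_
        rcases hyM with hm | hm
        · exact Or.inl ((inl_mem_Blt_iff Z₂ a₂ Z₃ y σ a₂).2 (Or.inr ⟨rfl, hm⟩))
        · exact Or.inr ((inl_mem_Mt_iff Z₂ a₂ Z₃ y σ a₂).2 (Or.inr ⟨rfl, hm⟩))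
      · refine h ((inr_mem_K_iff_of_anchor Z₂ a₂ Z₃ a₃ σ a y).2 ⟨hy, hj, hyK⟩) ?_
        rcases hyM with hm | hm
        · exact Or.inl ((inr_mem_Blt_iff Z₂ a₂ Z₃ a₃ σ y).2 ⟨hy, hm⟩)
        · exact Or.inr ((inr_mem_Mt_iff Z₂ a₂ Z₃ a₃ σ y).2 ⟨hy, hm⟩)
  · rintro ⟨h₂, h₃⟩ w hwK hwM
    rcases w with x | y
    · have hxK := (inl_mem_K_iff_of_anchor Z₂ a₂ Z₃ a₃ σ a x).1 hwK
      rcases hwM with hm | hm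
      · rcases (inl_mem_Blt_iff Z₂ a₂ Z₃ a₃ σ x).1 hm with hm' | ⟨rfl, hm'⟩
        · exact Set.disjoint_left.1 h₂ hxK (Or.inl hm')
        · exact Set.disjoint_left.1 (h₃ hxK) (mem_reach_of_mem rfl) (Or.inl hm')
      · rcases (inl_mem_Mt_iff Z₂ a₂ Z₃ a₃ σ x).1 hm with hm' | ⟨rfl, hm'⟩
        · exact Set.disjoint_left.1 h₂ hxK (Or.inr hm')
        · exact Set.disjoint_left.1 (h₃ hxK) (mem_reach_of_mem rfl) (Or.inr hm')
    · obtain ⟨hy, hj, hyK⟩ := (inr_mem_K_iff_of_anchor Z₂ a₂ Z₃ a₃ σ a y).1 hwK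
      rcases hwM with hm | hm
      · exact Set.disjoint_left.1 (h₃ hj) hyK (Or.inl ((inr_mem_Blt_iff Z₂ a₂ Z₃ a₃ σ y).1 hm).2)
      · exact Set.disjoint_left.1 (h₃ hj) hyK (Or.inr ((inr_mem_Mt_iff Z₂ a₂ Z₃ a₃ σ y).1 hm).2)

/-- A `Z₂`-vertex is deleted on side `2` iff it is so in `Z₂`, or the junction is deleted on side `2` and the
vertex lies in the junction's blue component of `Z₂`. -/
theorem inl_mem_D2_iff (x : V₂) :
    Sum.inl x ∈ (glue Z₂ a₂ Z₃ a₃).D2 σ ↔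
      x ∈ Z₂.D2 (restrL σ) ∨ (Sum.inl a₂ ∈ (glue Z₂ a₂ Z₃ a₃).D2 σ ∧ x ∈ Z₂.P {a₂} (restrL σ)) := by
  rw [inl_a_mem_D2_iff]
  have h := inl_mem_reach_iff Z₂ a₂ Z₃ a₃ false σ
    (markSet (Sum.elim (fun t => Sum.inl (Z₂.at₂ t)) (fun t => red a₂ a₃ (Z₃.at₂ t))) σ.2.2 false)
    (stray_not_mem_markSet_glue a₂ a₃ Z₂.at₂ Z₃.at₂ σ.2.2 false) x
  rw [junction_markSet_iff] at h
  have e1 : leftSet (markSet (Sum.elim (fun t => Sum.inl (Z₂.at₂ t)) (fun t => red a₂ a₃ (Z₃.at₂ t))) σ.2.2 false)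
      = {x | x ∈ Z₂.M (restrL σ) ∨ (x = a₂ ∧ a₃ ∈ Z₃.M (restrR σ))} := by
    ext x
    exact inl_mem_markSet_glue a₂ a₃ Z₂.at₂ Z₃.at₂ σ.2.2 false x
  rw [e1, mem_reach_union_condSingleton] at h
  refine h.trans ?_
  constructor
  · rintro ((h | ⟨h, hx⟩) | ⟨hj, hx⟩)
    · exact Or.inl h
    · exact Or.inr ⟨Or.inr (mem_reach_of_mem h), hx⟩
    · exact Or.inr ⟨hj, hx⟩
  · rintro (h | ⟨hj, hx⟩)
    · exact Or.inl (Or.inl h)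
    · exact Or.inr ⟨hj, hx⟩

end AnchorGlue

/-! ## The two-exit attachment -/

namespace TwoExit

open Pendant AnchorGlue

variable {V₁ E₁ U₁ U₂ V E T₁ T₂ V' E' T₁' T₂' : Type}
variable (Z₁ : ZoneData V₁ E₁ U₁ U₂) (u u' : V₁) (Z : ZoneData V E T₁ T₂) (a : V) (Z' : ZoneData V' E' T₁' T₂')
  (a' : V')

/-- THE TWO-EXIT ATTACHMENT: the unmarked multigraph `Z₁` with `Z'` hung at `u'` and `Z` hung at `u` (the anchor
gluing of `C041AnchorGlue` of the pendant attachment `pendant Z₁ u' Z' a'` with `Z`, at the junction `inl u`). -/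
noncomputable abbrev glue2 : ZoneData ((V₁ ⊕ V') ⊕ V) ((E₁ ⊕ E') ⊕ E) (T₁' ⊕ T₁) (T₂' ⊕ T₂) :=
  glue (pendant Z₁ u' Z' a') (Sum.inl u) Z a

variable (σ : State ((E₁ ⊕ E') ⊕ E) (T₁' ⊕ T₁) (T₂' ⊕ T₂))

/-- The colouring of `Z₁` in a state of the two-exit attachment. -/
def col₁ : E₁ → Bool := colL (restrL σ)

/-- The state of `Z'` in a state of the two-exit attachment. -/
def st' : State E' T₁' T₂' := restr (restrL σ)

/-- The state of `Z` in a state of the two-exit attachment. -/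
def st : State E T₁ T₂ := restrR σ

variable (a₁ : V₁)

/-- Blue connectivity inside `Z₁`, as `Mg`: `v` is blue-connected to `k`. -/
theorem mem_reach_blue_iff_Mg (ω : E₁ → Bool) (k v : V₁) :
    k ∈ reach (cAdj Z₁ false ω) {v} ↔ Z₁.Mg k v ω := by
  unfold Mg
  rw [← cAdj_false]
  exact ⟨fun h => mem_reach_singleton_symm (cAdj_symm Z₁ false ω) h,
    fun h => mem_reach_singleton_symm (cAdj_symm Z₁ false ω) h⟩

/-- The blue reach of the host from the junction `inl u`, at a `Z₁`-vertex: blue connectivity to `u` inside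
`Z₁` (the zone `Z'` adds nothing). -/
theorem inl_mem_P_junction_iff (v : V₁) :
    Sum.inl v ∈ (pendant Z₁ u' Z' a').P {Sum.inl u} (restrL σ) ↔ Z₁.Mg v u (col₁ σ) := by
  unfold P BlueAdj
  rw [adj_eq_cAdj, Pendant.inl_mem_reach_iff Z₁ u' Z' a' false (restrL σ) _ (stray_not_mem_singleton a' u),
    Pendant.junction_singleton_iff]
  have e1 : leftSet ({Sum.inl u} : Set (V₁ ⊕ V')) = {u} := by
    ext v
    simp [leftSet]
  rw [e1]
  unfold col₁
  rw [mem_reach_blue_iff_Mg, ← mem_reach_blue_iff_Mg]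
  constructor
  · rintro (h | ⟨hj, hv⟩)
    · exact h
    · exact mem_reach_singleton_trans hv hj
  · intro h
    exact Or.inl h

/-- The junction `inl (inl u)` is deleted iff `a` is deleted in `Z`, or `a'` is deleted in `Z'` and the two exits
are blue-connected. -/
theorem junction_mem_D_iff :
    Sum.inl (Sum.inl u) ∈ (glue2 Z₁ u u' Z a Z' a').D σ ↔
      (a' ∈ Z'.D (st' σ) ∧ Z₁.Mg u u' (col₁ σ)) ∨ a ∈ Z.D (st σ) := by
  rw [AnchorGlue.inl_a_mem_D_iff, Pendant.inl_mem_D_iff]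
  unfold st' st col₁
  rw [mem_reach_blue_iff_Mg]

/-- The junction is deleted on side `2` iff `a` is in `Z`, or `a'` is in `Z'` and the exits are blue-connected. -/
theorem junction_mem_D2_iff :
    Sum.inl (Sum.inl u) ∈ (glue2 Z₁ u u' Z a Z' a').D2 σ ↔
      (a' ∈ Z'.D2 (st' σ) ∧ Z₁.Mg u u' (col₁ σ)) ∨ a ∈ Z.D2 (st σ) := by
  rw [AnchorGlue.inl_a_mem_D2_iff, Pendant.inl_mem_D2_iff]
  unfold st' st col₁
  rw [mem_reach_blue_iff_Mg]

/-- Blue connectivity inside `Z₁` is symmetric. -/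
theorem Mg_symm (ω : E₁ → Bool) (k v : V₁) (h : Z₁.Mg k v ω) : Z₁.Mg v k ω :=
  mem_reach_singleton_symm (cAdj_symm Z₁ false ω) h

/-- Blue connectivity inside `Z₁` is transitive. -/
theorem Mg_trans (ω : E₁ → Bool) (k v w : V₁) (h1 : Z₁.Mg k v ω) (h2 : Z₁.Mg v w ω) : Z₁.Mg k w ω :=
  mem_reach_singleton_trans h2 h1

/-- **The anchor is deleted** iff `a'` is deleted in `Z'` and `u'` is merged, or `a` is deleted in `Z` and `u` is
merged. -/
theorem anchor_mem_D_iff :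
    Sum.inl (Sum.inl a₁) ∈ (glue2 Z₁ u u' Z a Z' a').D σ ↔
      (a' ∈ Z'.D (st' σ) ∧ Z₁.Mg a₁ u' (col₁ σ)) ∨ (a ∈ Z.D (st σ) ∧ Z₁.Mg a₁ u (col₁ σ)) := by
  rw [AnchorGlue.inl_mem_D_iff, junction_mem_D_iff, Pendant.inl_mem_D_iff, inl_mem_P_junction_iff]
  unfold st' col₁
  rw [mem_reach_blue_iff_Mg]
  constructor
  · rintro (h | ⟨(⟨hD', hc⟩ | hD), hm⟩)
    · exact Or.inl h
    · exact Or.inl ⟨hD', Mg_trans Z₁ _ _ _ _ hm hc⟩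
    · exact Or.inr ⟨hD, hm⟩
  · rintro (h | ⟨hD, hm⟩)
    · exact Or.inl h
    · exact Or.inr ⟨Or.inr hD, hm⟩

/-- **The anchor is deleted on side `2`** iff `a'` is in `Z'` and `u'` is merged, or `a` is in `Z` and `u` is
merged. -/
theorem anchor_mem_D2_iff :
    Sum.inl (Sum.inl a₁) ∈ (glue2 Z₁ u u' Z a Z' a').D2 σ ↔
      (a' ∈ Z'.D2 (st' σ) ∧ Z₁.Mg a₁ u' (col₁ σ)) ∨ (a ∈ Z.D2 (st σ) ∧ Z₁.Mg a₁ u (col₁ σ)) := by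
  rw [AnchorGlue.inl_mem_D2_iff, junction_mem_D2_iff, Pendant.inl_mem_D2_iff, inl_mem_P_junction_iff]
  unfold st' col₁
  rw [mem_reach_blue_iff_Mg]
  constructor
  · rintro (h | ⟨(⟨hD', hc⟩ | hD), hm⟩)
    · exact Or.inl h
    · exact Or.inl ⟨hD', Mg_trans Z₁ _ _ _ _ hm hc⟩
    · exact Or.inr ⟨hD, hm⟩
  · rintro (h | ⟨hD, hm⟩)
    · exact Or.inl h
    · exact Or.inr ⟨Or.inr hD, hm⟩

/-- **Admissibility of the two-exit attachment**: both zones admissible, and the junction `u` — which collects the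
blue marks of `Z` and, through a blue path to `u'`, those of `Z'` — not deleted on both sides. -/
theorem adm_iff :
    (glue2 Z₁ u u' Z a Z' a').adm σ ↔ Z'.adm (st' σ) ∧ Z.adm (st σ) ∧
      ¬ (((a' ∈ Z'.D (st' σ) ∧ Z₁.Mg u u' (col₁ σ)) ∨ a ∈ Z.D (st σ)) ∧
        ((a' ∈ Z'.D2 (st' σ) ∧ Z₁.Mg u u' (col₁ σ)) ∨ a ∈ Z.D2 (st σ))) := by
  rw [AnchorGlue.adm_iff, Pendant.adm_iff, junction_mem_D_iff, junction_mem_D2_iff]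
  rfl

/-- **Blue at `K` at the anchor**: a reached exit's zone is blue at its own `K`. -/
theorem blueK_iff :
    (glue2 Z₁ u u' Z a Z' a').blueK {Sum.inl (Sum.inl a₁)} σ ↔
      (Z₁.Rd a₁ u' (col₁ σ) → Z'.blueK {a'} (st' σ)) ∧ (Z₁.Rd a₁ u (col₁ σ) → Z.blueK {a} (st σ)) := by
  rw [blueK_iff_of_anchor, Pendant.blueK_iff, Pendant.inl_mem_K_iff]
  rfl

end TwoExit

end ZoneZ

end PercRepro
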